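import Summits.BirchSwinnertonDyer.BirchSwinnertonDyer.Theorems.PrintCFramBottomClassIndexLawFiveLeCutFormPeriodicCut
import HarnessLib

/-!
# Crux `PrintCFram.BottomClassIndexLawFiveLe` (stmt-BirchSwinnertonDyer-20372), line `eisenstein-resource-bdp-line` (registry v27):
# THE FLIPPED-CUSP RUNG, piece T5 layer B/1 — THE CUT SIDE: index algebra at the flipped prime
# (cell `bsd-print-cfram`, width seat `bsd-line-cfram-p1-w8` g9; THEOREMS ONLY, `--supports` 20372; BSD is not proved by any of this)

HONEST FRAMING. Nothing here is a statement about BSD; no registered stub is closed. Registry v27's `stub_flipRung` is reduced by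
layer A (`FlipRung.flipRung_six_of_rung`, p707470) to (Rung⁶): «`H(k, ·) ≡ 0 (mod p)` on the (3,0)-refined `τ`-cut ⟹ the same on the
cut flipped at `q`». The modular side (T1 w6 g9, T2 w2 g14, T3 w4 g19, T4 w3 g19, vehicle (G)) works with the AWAY-FROM-`q` cut of
Cohen's `H_k` (a form of level PRIME TO `q`) and the Legendre projector `P_σ` at `q`. This file is the index algebra relating the two
cuts (modular-form-free):

* `fullCut_iff_awayCut_and_at` — for an odd prime `q ∥ m`, `m_q := m/q`: the FULL `τ`-cut condition on an index `n` (`m ∣ n`,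
  `n/m ≡ 3 (4)`, `J(−n/m | q') = τ(q')` at the odd `q' ∣ m`, `n/m ≡ 7 (8)` if `2 ∣ m`, `3 ∤ n/m` — the clause shape of (Rung⁶)) is
  EQUIVALENT to the AWAY-FROM-`q` condition (`m_q ∣ n`, `ν := n/m_q ≡ 3q (4)`, `J(−ν | q') = τ(q')·J(q | q')` at the odd `q' ∣ m_q`,
  `ν ≡ 7q (8)` if `2 ∣ m`, `3 ∤ ν` if `q ≠ 3`) TOGETHER WITH the data AT `q`: `q ∥ n` and the Legendre class
  `J(n/q | q) = τ(q)·J(−1 | q)·J(m_q | q)` (the currency of T1's `P_σ`: `σ = τ(q)·J(−1 | q)·J(m_q | q)`; flipping `τ` at `q` flips `σ`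
  and leaves the away condition unchanged);
* `awayResidue_add_iff`, `awayCut_add_iff` — the away condition is PERIODIC with any period `m_q·D`, `8 ∣ D`, `q' ∣ D` for the primes
  `q' ∣ m_q`, `3 ∣ D` unless `q = 3` (w3 g12's `CutForm.cuspCutResidue_add_iff` re-keyed); `exists_period_awayCut_coprime` — a period
  `Q₀` with `q ∤ Q₀`, `m_q ∣ Q₀`, `8 ∣ Q₀` exists (the input of the periodic-twist construction of the away-cut form, vehicle (G));
* helpers `mul_mod_four_eq_iff`, `mul_mod_eight_eq_iff` (`q·n ≡ 3q (4) ⟺ n ≡ 3 (4)`, `q·n ≡ 7q (8) ⟺ n ≡ 7 (8)`, `q` odd),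
  `not_dvd_of_jacobiSym_neg_eq_sign`.

No definitions, no named facts, no `sorry`. beyond-print theorem: NO (bookkeeping). References: crux notes lead-g14 §2.1–§2.5; [Cohen1975] Thm. 3.1.
-/

set_option autoImplicit false
-- summit-side namespace `Summit.BirchSwinnertonDyer.BirchSwinnertonDyer.…` (single-conjunct summit, D-0017 layout)
set_option linter.dupNamespace false

noncomputable section

open scoped Classical NumberTheorySymbols
open PowerSeries

namespace Summit.BirchSwinnertonDyer.BirchSwinnertonDyer.Theorems.PrintCFram.FlipRung

open Summit.BirchSwinnertonDyer.BirchSwinnertonDyer.Theorems.PrintCFram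

/-! ## §1 Index algebra at the flipped prime -/

/-- `q·n ≡ 3q (mod 4) ⟺ n ≡ 3 (mod 4)` for odd `q`. [folklore] -/
theorem mul_mod_four_eq_iff {q : ℕ} (hq : q % 2 = 1) (n : ℕ) : q * n % 4 = 3 * q % 4 ↔ n % 4 = 3 := by
  have h1 : q * n % 4 = (q % 4) * (n % 4) % 4 := Nat.mul_mod _ _ _
  have h2 : 3 * q % 4 = 3 * (q % 4) % 4 := by conv_lhs => rw [Nat.mul_mod]
  have hr : q % 4 = 1 ∨ q % 4 = 3 := by omega
  have hs : n % 4 < 4 := Nat.mod_lt _ (by norm_num)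
  rw [h1, h2]
  generalize n % 4 = s at hs ⊢
  rcases hr with hr | hr <;> rw [hr] <;> interval_cases s <;> omega

/-- `q·n ≡ 7q (mod 8) ⟺ n ≡ 7 (mod 8)` for odd `q`. [folklore] -/
theorem mul_mod_eight_eq_iff {q : ℕ} (hq : q % 2 = 1) (n : ℕ) : q * n % 8 = 7 * q % 8 ↔ n % 8 = 7 := by
  have h1 : q * n % 8 = (q % 8) * (n % 8) % 8 := Nat.mul_mod _ _ _
  have h2 : 7 * q % 8 = 7 * (q % 8) % 8 := by conv_lhs => rw [Nat.mul_mod]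
  have hr : q % 8 = 1 ∨ q % 8 = 3 ∨ q % 8 = 5 ∨ q % 8 = 7 := by omega
  have hs : n % 8 < 8 := Nat.mod_lt _ (by norm_num)
  rw [h1, h2]
  generalize n % 8 = s at hs ⊢
  rcases hr with hr | hr | hr | hr <;> rw [hr] <;> interval_cases s <;> omega

/-- A Jacobi symbol `J(−n | q)` (`q` prime) with value `±1` forces `q ∤ n`. [folklore] -/
theorem not_dvd_of_jacobiSym_neg_eq_sign {q n : ℕ} (hq : q.Prime) {t : ℤ} (ht : t = 1 ∨ t = -1)
    (h : jacobiSym (-((n : ℕ) : ℤ)) q = t) : ¬ q ∣ n := by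
  haveI : NeZero q := ⟨hq.ne_zero⟩
  intro hdvd
  have h0 : jacobiSym (-((n : ℕ) : ℤ)) q = 0 := by
    refine jacobiSym.eq_zero_iff_not_coprime.mpr fun hg => ?_
    rw [Int.gcd_eq_natAbs, Int.natAbs_neg, Int.natAbs_natCast, Int.natAbs_natCast] at hg
    have : q ∣ Nat.gcd n q := Nat.dvd_gcd hdvd dvd_rfl
    rw [hg] at this
    exact hq.one_lt.ne' (Nat.dvd_one.mp this)
  rw [h0] at h
  rcases ht with rfl | rfl <;> norm_num at h

/-- **The FULL `τ`-cut condition ⟺ the AWAY-FROM-`q` condition ∧ the data at `q`** (`q` an odd prime, `q ∥ m`, `m_q = m/q`; see the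
module docstring for the two index predicates, written out). The class at `q` is read as `J(n/q | q) = τ(q)·J(−1 | q)·J(m_q | q)`
(`n/q = m_q·n'`, `J(−n' | q) = J(−1 | q)·J(n' | q)`), the currency of T1's Legendre cut `P_σ`. [folklore] -/
theorem fullCut_iff_awayCut_and_at {m q : ℕ} (hq : q.Prime) (hq2 : q ≠ 2) (hqm : q ∣ m) (hqm2 : ¬ q ^ 2 ∣ m)
    {τ : ℕ → ℤ} (hτ : ∀ q' : ℕ, q'.Prime → q' ∣ m → q' ≠ 2 → (τ q' = 1 ∨ τ q' = -1)) (n : ℕ) :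
    (m ∣ n ∧ n / m % 4 = 3 ∧ (∀ q' : ℕ, q'.Prime → q' ∣ m → q' ≠ 2 → jacobiSym (-((n / m : ℕ) : ℤ)) q' = τ q') ∧
        (2 ∣ m → n / m % 8 = 7) ∧ ¬ 3 ∣ n / m) ↔
      ((m / q ∣ n ∧ n / (m / q) % 4 = 3 * q % 4 ∧
          (∀ q' : ℕ, q'.Prime → q' ∣ m / q → q' ≠ 2 →
            jacobiSym (-((n / (m / q) : ℕ) : ℤ)) q' = τ q' * jacobiSym (q : ℤ) q') ∧
          (2 ∣ m → n / (m / q) % 8 = 7 * q % 8) ∧ (q ≠ 3 → ¬ 3 ∣ n / (m / q))) ∧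
        (q ∣ n ∧ ¬ q ^ 2 ∣ n ∧
          jacobiSym ((n / q : ℕ) : ℤ) q = τ q * jacobiSym (-1) q * jacobiSym ((m / q : ℕ) : ℤ) q)) := by
  have hq0 : 0 < q := hq.pos
  have hqodd : q % 2 = 1 := Nat.odd_iff.mp (hq.eq_two_or_odd'.resolve_left hq2)
  obtain ⟨mq, hm⟩ := hqm
  have hmq_def : m / q = mq := by rw [hm, Nat.mul_div_cancel_left _ hq0]
  -- `q ∤ m_q` from `q² ∤ m`
  have hqmq : ¬ q ∣ mq := by
    rintro ⟨c, rfl⟩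
    exact hqm2 ⟨c, by rw [hm]; ring⟩
  rw [hmq_def]
  haveI : NeZero q := ⟨hq.ne_zero⟩
  have hτq : τ q = 1 ∨ τ q = -1 := hτ q hq ⟨mq, hm⟩ hq2
  have hJm1 : jacobiSym (-1) q * jacobiSym (-1) q = 1 := by
    rw [← jacobiSym.mul_left]; norm_num [jacobiSym.one_left]
  have hJmq : jacobiSym ((mq : ℕ) : ℤ) q ≠ 0 := by
    rw [Ne, jacobiSym.eq_zero_iff_not_coprime, not_not, Int.gcd_natCast_natCast]
    exact Nat.coprime_comm.mp ((Nat.Prime.coprime_iff_not_dvd hq).mpr hqmq)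
  -- primes of `m_q` are primes of `m` other than `q`
  have hprimes : ∀ q' : ℕ, q'.Prime → q' ∣ mq → q' ∣ m ∧ q' ≠ q := fun q' hq' h =>
    ⟨h.trans ⟨q, by rw [hm]; ring⟩, fun e => hqmq (e ▸ h)⟩
  have hJqq : ∀ q' : ℕ, q'.Prime → q' ≠ q → jacobiSym (q : ℤ) q' * jacobiSym (q : ℤ) q' = 1 := by
    intro q' hq' hne
    haveI : NeZero q' := ⟨hq'.ne_zero⟩
    have hcop : ((q : ℤ)).gcd q' = 1 := by
      rw [Int.gcd_natCast_natCast]; exact (Nat.coprime_primes hq hq').mpr (Ne.symm hne)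
    rw [← jacobiSym.mul_left, ← pow_two]; exact jacobiSym.sq_one' hcop
  constructor
  · -- FULL ⟹ AWAY ∧ AT
    rintro ⟨hmn, h4, hJ, h8, h3⟩
    obtain ⟨n', hn⟩ := hmn
    have hm0 : 0 < m := by
      rcases Nat.eq_zero_or_pos m with h | h
      · exfalso; rw [h, zero_mul] at hn; rw [hn, h, Nat.zero_div] at h4; norm_num at h4
      · exact h
    have hmq0 : 0 < mq := by
      rcases Nat.eq_zero_or_pos mq with h | h
      · rw [h, mul_zero] at hm; omega
      · exact h
    have hn' : n / m = n' := by rw [hn, Nat.mul_div_cancel_left _ hm0]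
    rw [hn'] at h4 hJ h8 h3
    have hν : n / mq = q * n' := by
      rw [hn, hm, show q * mq * n' = mq * (q * n') by ring, Nat.mul_div_cancel_left _ hmq0]
    have hqn' : ¬ q ∣ n' := not_dvd_of_jacobiSym_neg_eq_sign hq hτq (hJ q hq ⟨mq, hm⟩ hq2)
    refine ⟨⟨⟨q * n', by rw [hn, hm]; ring⟩, ?_, ?_, ?_, ?_⟩, ⟨⟨mq * n', by rw [hn, hm]; ring⟩, ?_, ?_⟩⟩
    · rw [hν]; exact (mul_mod_four_eq_iff hqodd n').mpr h4
    · intro q' hq' hq'm hq'2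
      obtain ⟨hq'm', -⟩ := hprimes q' hq' hq'm
      rw [hν, show (-((q * n' : ℕ) : ℤ)) = (-((n' : ℕ) : ℤ)) * (q : ℤ) by push_cast; ring, jacobiSym.mul_left,
        hJ q' hq' hq'm' hq'2]
    · intro h2
      rw [hν]; exact (mul_mod_eight_eq_iff hqodd n').mpr (h8 h2)
    · intro hq3 h3ν
      rw [hν] at h3ν
      rcases (Nat.Prime.dvd_mul Nat.prime_three).mp h3ν with h | h
      · exact hq3 ((Nat.prime_dvd_prime_iff_eq Nat.prime_three hq).mp h).symm
      · exact h3 h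
    · rintro ⟨c, hc⟩
      apply hqn'
      have hqmn : q ∣ mq * n' := by
        refine ⟨c, Nat.eq_of_mul_eq_mul_left hq0 ?_⟩
        calc q * (mq * n') = n := by rw [hn, hm]; ring
          _ = q * (q * c) := by rw [hc]; ring
      exact ((Nat.Prime.dvd_mul hq).mp hqmn).resolve_left hqmq
    · have hnq : n / q = mq * n' := by
        rw [hn, hm, show q * mq * n' = q * (mq * n') by ring, Nat.mul_div_cancel_left _ hq0]
      have hJq := hJ q hq ⟨mq, hm⟩ hq2
      rw [show (-((n' : ℕ) : ℤ)) = (-1) * ((n' : ℕ) : ℤ) by ring, jacobiSym.mul_left] at hJq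
      have hn'q : jacobiSym ((n' : ℕ) : ℤ) q = τ q * jacobiSym (-1) q := by
        calc jacobiSym ((n' : ℕ) : ℤ) q
            = (jacobiSym (-1) q * jacobiSym (-1) q) * jacobiSym ((n' : ℕ) : ℤ) q := by rw [hJm1, one_mul]
          _ = jacobiSym (-1) q * (jacobiSym (-1) q * jacobiSym ((n' : ℕ) : ℤ) q) := by ring
          _ = jacobiSym (-1) q * τ q := by rw [hJq]
          _ = τ q * jacobiSym (-1) q := by ring
      rw [hnq, Nat.cast_mul, jacobiSym.mul_left, hn'q]; ring
  · -- AWAY ∧ AT ⟹ FULL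
    rintro ⟨⟨hmqn, h4, hJ, h8, h3⟩, hqn, hq2n, hcls⟩
    obtain ⟨ν, hν⟩ := hmqn
    have hmq0 : 0 < mq := by
      rcases Nat.eq_zero_or_pos mq with h | h
      · exfalso
        rw [h, zero_mul] at hν
        rw [hν, h] at h4
        simp at h4
        omega
      · exact h
    have hνdef : n / mq = ν := by rw [hν, Nat.mul_div_cancel_left _ hmq0]
    rw [hνdef] at h4 hJ h8 h3
    have hqν : q ∣ ν := ((Nat.Prime.dvd_mul hq).mp (hν ▸ hqn)).resolve_left hqmq
    obtain ⟨n', rfl⟩ := hqν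
    have hm0 : 0 < m := by rw [hm]; positivity
    have hn : n = m * n' := by rw [hν, hm]; ring
    have hn' : n / m = n' := by rw [hn, Nat.mul_div_cancel_left _ hm0]
    have hqn' : ¬ q ∣ n' := by
      rintro ⟨c, rfl⟩
      exact hq2n ⟨mq * c, by rw [hn, hm]; ring⟩
    rw [hn']
    refine ⟨⟨n', hn⟩, (mul_mod_four_eq_iff hqodd n').mp h4, ?_, fun h2 => (mul_mod_eight_eq_iff hqodd n').mp (h8 h2), ?_⟩
    · -- Jacobi clauses at every odd `q' ∣ m`
      intro q' hq' hq'm hq'2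
      by_cases hqq : q' = q
      · subst hqq
        -- the class at `q`
        have hnq : n / q' = mq * n' := by
          rw [hn, hm, show q' * mq * n' = q' * (mq * n') by ring, Nat.mul_div_cancel_left _ hq0]
        rw [hnq, Nat.cast_mul, jacobiSym.mul_left] at hcls
        -- cancel `J(m_q | q) ≠ 0`
        have hn'q : jacobiSym ((n' : ℕ) : ℤ) q' = τ q' * jacobiSym (-1) q' := by
          refine mul_right_cancel₀ hJmq ?_
          linear_combination hcls
        rw [show (-((n' : ℕ) : ℤ)) = (-1) * ((n' : ℕ) : ℤ) by ring, jacobiSym.mul_left, hn'q]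
        calc jacobiSym (-1) q' * (τ q' * jacobiSym (-1) q') = τ q' * (jacobiSym (-1) q' * jacobiSym (-1) q') := by ring
          _ = τ q' := by rw [hJm1, mul_one]
      · -- `q' ∣ m_q`
        have hq'mq : q' ∣ mq := by
          have : q' ∣ q * mq := hm ▸ hq'm
          exact ((Nat.Prime.dvd_mul hq').mp this).resolve_left
            (fun h => hqq ((Nat.prime_dvd_prime_iff_eq hq' hq).mp h))
        have h := hJ q' hq' hq'mq hq'2
        rw [show (-((q * n' : ℕ) : ℤ)) = (-((n' : ℕ) : ℤ)) * (q : ℤ) by push_cast; ring, jacobiSym.mul_left] at h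
        have h2 : jacobiSym (-((n' : ℕ) : ℤ)) q' * jacobiSym (q : ℤ) q' * jacobiSym (q : ℤ) q' =
            τ q' * jacobiSym (q : ℤ) q' * jacobiSym (q : ℤ) q' := by rw [h]
        rw [mul_assoc, hJqq q' hq' hqq, mul_one, mul_assoc, hJqq q' hq' hqq, mul_one] at h2
        exact h2
    · -- `3 ∤ n'`
      intro h3n'
      by_cases hq3 : q = 3
      · subst hq3
        exact hqn' h3n'
      · exact h3 hq3 (dvd_mul_of_dvd_right h3n' q)

/-- The residue conditions of the AWAY-FROM-`q` cut on `ν = n/m_q` are invariant under `ν ↦ ν + D` whenever `8 ∣ D`, every prime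
`q' ∣ m_q` divides `D`, and `3 ∣ D` unless `q = 3` (w3 g12's `CutForm.cuspCutResidue_add_iff`, re-keyed to a sign pattern and scaled by `q`).
[folklore] -/
theorem awayResidue_add_iff (m mq q : ℕ) (τ : ℕ → ℤ) (ν D : ℕ) (h8 : 8 ∣ D)
    (hq' : ∀ q' : ℕ, q'.Prime → q' ∣ mq → q' ∣ D) (h3 : q ≠ 3 → 3 ∣ D) :
    ((ν + D) % 4 = 3 * q % 4 ∧
        (∀ q' : ℕ, q'.Prime → q' ∣ mq → q' ≠ 2 →
          jacobiSym (-(((ν + D : ℕ)) : ℤ)) q' = τ q' * jacobiSym (q : ℤ) q') ∧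
        (2 ∣ m → (ν + D) % 8 = 7 * q % 8) ∧ (q ≠ 3 → ¬ 3 ∣ ν + D)) ↔
      (ν % 4 = 3 * q % 4 ∧
        (∀ q' : ℕ, q'.Prime → q' ∣ mq → q' ≠ 2 → jacobiSym (-((ν : ℕ) : ℤ)) q' = τ q' * jacobiSym (q : ℤ) q') ∧
        (2 ∣ m → ν % 8 = 7 * q % 8) ∧ (q ≠ 3 → ¬ 3 ∣ ν)) := by
  obtain ⟨D8, rfl⟩ := h8
  have h4 : (ν + 8 * D8) % 4 = ν % 4 := by
    rw [show ν + 8 * D8 = ν + 4 * (2 * D8) by ring, Nat.add_mul_mod_self_left]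
  have h8' : (ν + 8 * D8) % 8 = ν % 8 := by rw [Nat.add_mul_mod_self_left]
  have hJ : ∀ q' : ℕ, q'.Prime → q' ∣ mq →
      jacobiSym (-(((ν + 8 * D8 : ℕ)) : ℤ)) q' = jacobiSym (-((ν : ℕ) : ℤ)) q' := by
    intro q' hqp hqm
    obtain ⟨D', hD'⟩ := hq' q' hqp hqm
    rw [jacobiSym.mod_left, jacobiSym.mod_left (-((ν : ℕ) : ℤ)) q']
    congr 1
    rw [hD']
    push_cast
    rw [show -((ν : ℤ) + (q' : ℤ) * D') = -(ν : ℤ) + (q' : ℤ) * (-(D' : ℤ)) by ring, Int.add_mul_emod_self_left]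
  have h3' : (q ≠ 3 → ¬ 3 ∣ ν + 8 * D8) ↔ (q ≠ 3 → ¬ 3 ∣ ν) := by
    constructor
    · intro h hq3; have := h hq3; rwa [Nat.dvd_add_left (h3 hq3)] at this
    · intro h hq3; rw [Nat.dvd_add_left (h3 hq3)]; exact h hq3
  rw [h4, h8', h3']
  constructor
  · rintro ⟨h1, h2, h5, h6⟩
    exact ⟨h1, fun q' hqp hqm hq2 ↦ (hJ q' hqp hqm) ▸ h2 q' hqp hqm hq2, h5, h6⟩
  · rintro ⟨h1, h2, h5, h6⟩
    exact ⟨h1, fun q' hqp hqm hq2 ↦ (hJ q' hqp hqm).symm ▸ h2 q' hqp hqm hq2, h5, h6⟩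

/-- **The AWAY-FROM-`q` cut index predicate is periodic** with any period `m_q·D` such that `8 ∣ D`, every prime of `m_q` divides `D`,
and `3 ∣ D` unless `q = 3`: `AWAY(n + m_q·D·t) ↔ AWAY(n)` (`m = q·m_q` enters only through the parity clause `2 ∣ m`). [folklore] -/
theorem awayCut_add_iff (m mq q : ℕ) (τ : ℕ → ℤ) (D n t : ℕ) (hmq : 0 < mq) (h8 : 8 ∣ D)
    (hq' : ∀ q' : ℕ, q'.Prime → q' ∣ mq → q' ∣ D) (h3 : q ≠ 3 → 3 ∣ D) :
    (mq ∣ n + mq * D * t ∧ (n + mq * D * t) / mq % 4 = 3 * q % 4 ∧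
        (∀ q' : ℕ, q'.Prime → q' ∣ mq → q' ≠ 2 →
          jacobiSym (-(((n + mq * D * t) / mq : ℕ) : ℤ)) q' = τ q' * jacobiSym (q : ℤ) q') ∧
        (2 ∣ m → (n + mq * D * t) / mq % 8 = 7 * q % 8) ∧ (q ≠ 3 → ¬ 3 ∣ (n + mq * D * t) / mq)) ↔
      (mq ∣ n ∧ n / mq % 4 = 3 * q % 4 ∧
        (∀ q' : ℕ, q'.Prime → q' ∣ mq → q' ≠ 2 →
          jacobiSym (-((n / mq : ℕ) : ℤ)) q' = τ q' * jacobiSym (q : ℤ) q') ∧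
        (2 ∣ m → n / mq % 8 = 7 * q % 8) ∧ (q ≠ 3 → ¬ 3 ∣ n / mq)) := by
  have hdiv : (n + mq * D * t) / mq = n / mq + D * t := by
    rw [show mq * D * t = mq * (D * t) by ring, Nat.add_mul_div_left _ _ hmq]
  have hdvd : mq ∣ n + mq * D * t ↔ mq ∣ n := by
    rw [show mq * D * t = mq * (D * t) by ring]
    exact Nat.dvd_add_left (dvd_mul_right mq _)
  have h8t : 8 ∣ D * t := h8.mul_right t
  have hq't : ∀ q' : ℕ, q'.Prime → q' ∣ mq → q' ∣ D * t := fun q' hq hqm ↦ (hq' q' hq hqm).mul_right t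
  have h3t : q ≠ 3 → 3 ∣ D * t := fun h ↦ (h3 h).mul_right t
  rw [hdiv, hdvd, awayResidue_add_iff m mq q τ (n / mq) (D * t) h8t hq't h3t]

/-- **A period of the AWAY-FROM-`q` cut prime to `q`** (`q` an odd prime not dividing `m_q`): with `D = 24·m_q` (`q ≠ 3`) or `D = 8·m_q`
(`q = 3`), the predicate is periodic with period `Q₀ = m_q·D` and `q ∤ Q₀` — the shape the periodic-twist construction of the away-cut form
(vehicle (G)) consumes. [folklore] -/
theorem exists_period_awayCut_coprime (m mq q : ℕ) (τ : ℕ → ℤ) (hmq : 0 < mq) (hq : q.Prime) (hq2 : q ≠ 2) (hqmq : ¬ q ∣ mq) :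
    ∃ Q₀ : ℕ, 0 < Q₀ ∧ ¬ q ∣ Q₀ ∧ mq ∣ Q₀ ∧ 8 ∣ Q₀ ∧
      Function.Periodic (fun n : ℕ =>
        mq ∣ n ∧ n / mq % 4 = 3 * q % 4 ∧
          (∀ q' : ℕ, q'.Prime → q' ∣ mq → q' ≠ 2 →
            jacobiSym (-((n / mq : ℕ) : ℤ)) q' = τ q' * jacobiSym (q : ℤ) q') ∧
          (2 ∣ m → n / mq % 8 = 7 * q % 8) ∧ (q ≠ 3 → ¬ 3 ∣ n / mq)) Q₀ := by
  classical
  set c : ℕ := if q = 3 then 1 else 3 with hc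
  have hc0 : 0 < c := by rw [hc]; split_ifs <;> norm_num
  have hqc : ¬ q ∣ c := by
    rw [hc]; split_ifs with h
    · exact fun hd => hq.one_lt.ne' (Nat.dvd_one.mp hd)
    · intro hd
      exact h ((Nat.prime_dvd_prime_iff_eq hq Nat.prime_three).mp hd)
  refine ⟨mq * (8 * mq * c), by positivity, ?_, dvd_mul_right _ _, ?_, ?_⟩
  · intro hd
    rcases (Nat.Prime.dvd_mul hq).mp hd with h | h
    · exact hqmq h
    rcases (Nat.Prime.dvd_mul hq).mp h with h | h
    · rcases (Nat.Prime.dvd_mul hq).mp h with h | h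
      · have : q ≤ 8 := Nat.le_of_dvd (by norm_num) h
        interval_cases q <;> simp_all (config := {decide := true})
      · exact hqmq h
    · exact hqc h
  · exact Dvd.dvd.mul_left (Dvd.dvd.mul_right (dvd_mul_right 8 mq) c) mq
  · intro n
    simp only
    have h := awayCut_add_iff m mq q τ (8 * mq * c) n 1 hmq ⟨mq * c, by ring⟩
      (fun q' _ hqm => Dvd.dvd.mul_right (Dvd.dvd.mul_left hqm 8) c)
      (fun hq3 => ⟨8 * mq, by rw [hc, if_neg hq3]; ring⟩)
    rw [mul_one] at h
    exact propext h

end Summit.BirchSwinnertonDyer.BirchSwinnertonDyer.Theorems.PrintCFram.FlipRung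

end
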